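import Literature.AlgebraicGeometry.Motives.FamiliesVHSIsometryTensor
import Literature.AlgebraicGeometry.Motives.FamiliesVHSProd
import Literature.AlgebraicGeometry.Motives.FamiliesVHSComap
import HarnessLib

/-!
# Pull-back of VHS data commutes with the tensor constructions: `f*(D₁ ⊗ D₂) = f*D₁ ⊗ f*D₂`, `f*(D₁ ⊕ D₂)`, `f*(D(j))`, `f*ℤ_S(j) = ℤ_{S'}(j)`,
# `f*(D^{⊗m})` on the nose, and `f*(D^∨) ≅ (f*D)^∨`, `f*Hom(D₁, D₂) ≅ Hom(f*D₁, f*D₂)`, `f*(T^{a,b}D) ≅ T^{a,b}(f*D)` by isometric isomorphisms;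
# hence the Cattani–Deligne–Kaplan loci of the tensor constructions of `f*D` are the preimages of those of `D`

Topic `Literature/AlgebraicGeometry/Motives` (namespace `Literature.AlgebraicGeometry.Motives.VHSData`), lane `lit-hodgefound` (seat `p08`, row g57-#14).
DEFINITIONS WITH BODIES (the isomorphisms `Iso.dualComap`, `Iso.homComap`, `Iso.tensorSpaceComap`) and THEOREMS; no named fact, no instance, no notation
(D-0026 net debt `0`).  Sequel of `Motives/FamiliesVHSComap` (`VHSData.comap`, `hodgeLocusOfNormLe_comap`) and of the `⊗`-toolkit.

PRINTED SOURCES.  P. Deligne, *Équations différentielles à points singuliers réguliers*, LNM 163 (1970), I.1 (inverse image of local systems is a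
`⊗`-functor: it commutes with `⊗`, duals, `Hom`).  W. Schmid, *Variation of Hodge structure*, §2 (variations pull back with all their data).  E. Cattani,
P. Deligne, A. Kaplan, *On the locus of Hodge classes*, J. AMS 8 (1995), «Proof of 1.5 ⟹ 1.1» (p. 485): «one is free to replace `S` by a finite etale
covering `S' → S`» — for the tensor constructions `T^{a,b}𝒱` this uses `T^{a,b}(f*𝒱) ≅ f*(T^{a,b}𝒱)`.

* §1 ON THE NOSE (`rfl`): `comap_tensor`, `comap_prod`, `comap_tateTwist`, `comap_cast`, `comap_tate`, `comap_unit`, `comap_tensorPow` (induction).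
* §2 **`Iso.dualComap D f : f*(D^∨) ≅ (f*D)^∨`** — identity lattice maps; flat because the transports along `(f∘γ)⁻¹` and `f∘γ⁻¹` are both the inverse
  of the transport along `f∘γ` (`LocalSystem.transport_map_symm`); an isometry; **`Iso.homComap`**, **`Iso.tensorSpaceComap`**, isometric.
* §3 **CDK loci**: `hodgeLocusOfNormLe ((f*D)^{⊗m}) = f⁻¹' hodgeLocusOfNormLe (D^{⊗m})`, the same for `T^{a,b}`, `(f*D)^∨`, `Hom(f*D₁, f*D₂)`, `f*D₁ ⊗ f*D₂`.

HONEST SCOPE: as for every `VHSData`, holomorphy ∕ transversality are not recorded.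

## References

* [Deligne1970] P. Deligne, *Équations différentielles à points singuliers réguliers*, LNM 163 (1970), I.1.
* [Schmid1973] W. Schmid, *Variation of Hodge structure: the singularities of the period mapping*, Invent. Math. 22 (1973), §2.
* [CattaniDeligneKaplan1995] E. Cattani, P. Deligne, A. Kaplan, *On the locus of Hodge classes*, J. Amer. Math. Soc. 8 (1995), «Proof of 1.5 ⟹ 1.1» (p. 485).
-/

noncomputable section

open CategoryTheory Set
open scoped TensorProduct

namespace Literature.AlgebraicGeometry.Motives

/-! ## §0 Local systems: the transport along `(f∘γ)⁻¹` is the transport of `f*V` along `γ⁻¹` -/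

namespace LocalSystem

universe u

variable {R : Type u} [CommRing R] {S : Type u} [TopologicalSpace S] {S' : Type u} [TopologicalSpace S'] (V : LocalSystem R S) (f : C(S', S))

/-- Along a path `γ` of `S'`, the transport of `V` along `(f∘γ)⁻¹` equals the transport of `f*V` along `γ⁻¹` (both are the inverse of the transport
along `f∘γ`). [cite: Deligne1970, I.1] -/
theorem transport_map_symm {s' t' : S'} (γ : Path.Homotopic.Quotient s' t') : V.transport (γ.map f).symm = (V.comap f).transport γ.symm :=
  LinearMap.ext fun v =>
    calc V.transport (γ.map f).symm v
        = V.transport (γ.map f).symm ((V.comap f).transport γ ((V.comap f).transport γ.symm v)) := by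
          rw [(V.comap f).transport_apply_transport_symm γ v]
      _ = (V.comap f).transport γ.symm v := V.transport_symm_apply_transport (γ.map f) _

/-- Hence `f*(V^∨)` and `(f*V)^∨` have the same transports. [cite: Deligne1970, I.1] -/
theorem dual_comap_transport {s' t' : S'} (γ : Path.Homotopic.Quotient s' t') : (V.dual.comap f).transport γ = (V.comap f).dual.transport γ :=
  congrArg LinearMap.dualMap (V.transport_map_symm f γ)

end LocalSystem

namespace VHSData

variable {S : Type} [TopologicalSpace S] {S' : Type} [TopologicalSpace S'] {k k₁ k₂ : ℤ} (f : C(S', S))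

/-! ## §1 On the nose -/

/-- **`f*(D₁ ⊗ D₂) = f*D₁ ⊗ f*D₂`.** [cite: Deligne1970, I.1] [cite: Schmid1973, §2] -/
theorem comap_tensor (D₁ : VHSData S k₁) (D₂ : VHSData S k₂) : (D₁.tensor D₂).comap f = (D₁.comap f).tensor (D₂.comap f) := rfl

/-- **`f*(D₁ ⊕ D₂) = f*D₁ ⊕ f*D₂`.** [cite: Deligne1970, I.1] [cite: Schmid1973, §2] -/
theorem comap_prod (D₁ D₂ : VHSData S k) : (D₁.prod D₂).comap f = (D₁.comap f).prod (D₂.comap f) := rfl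

/-- **`f*(D(j)) = (f*D)(j)`.** [cite: Schmid1973, §2] -/
theorem comap_tateTwist (D : VHSData S k) (j : ℤ) : (D.tateTwist j).comap f = (D.comap f).tateTwist j := rfl

/-- `f*(D.cast h) = (f*D).cast h`. [cite: Schmid1973, §2] -/
theorem comap_cast (D : VHSData S k) (h : k = k₁) : (D.cast h).comap f = (D.comap f).cast h := rfl

/-- **`f*ℤ_S(j) = ℤ_{S'}(j)`.** [cite: Deligne1970, I.1] -/
theorem comap_tate (j : ℤ) : (tate S j).comap f = tate S' j := rfl

/-- **`f*ℤ_S = ℤ_{S'}`.** [cite: Deligne1970, I.1] -/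
theorem comap_unit : (unit S).comap f = unit S' := rfl

/-- **`f*(D^{⊗m}) = (f*D)^{⊗m}`.** [cite: Deligne1970, I.1] [cite: Schmid1973, §2] -/
theorem comap_tensorPow (D : VHSData S k) (m : ℕ) : (D.tensorPow m).comap f = (D.comap f).tensorPow m := by
  induction m with
  | zero => rfl
  | succ m ih => rw [tensorPow_succ, tensorPow_succ, ← ih]; rfl

/-! ## §2 `f*(D^∨) ≅ (f*D)^∨`, `f*Hom(D₁, D₂) ≅ Hom(f*D₁, f*D₂)`, `f*(T^{a,b} D) ≅ T^{a,b}(f*D)` -/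

section Dual

variable (D : VHSData S k)

/-- A filtration step is preserved by the base change of a map that is pointwise the identity. [folklore] -/
private theorem map_baseChange_le_of_forall_eq {V : Type*} [AddCommGroup V] [Module ℚ V] (g : V →ₗ[ℚ] V) (hg : ∀ v, g v = v)
    (F : Submodule ℂ (ℂ ⊗[ℚ] V)) : F.map (g.baseChange ℂ) ≤ F := by
  rw [show g = LinearMap.id from LinearMap.ext hg, LinearMap.baseChange_id, Submodule.map_id]

/-- The rationalization of the identity lattice map `f*(D^∨) → (f*D)^∨` is the identity (the comparison maps `V_ℤ → V` of the two agree).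
[cite: Schmid1973, §2] -/
theorem homRat_dual_comap_id_apply (s' : S') (v : D.dual.V.fiber (f s')) : (D.dual.comap f).homRat ((D.comap f).dual) s' LinearMap.id v = v :=
  LinearMap.congr_fun ((D.dual.comap f).homRat_unique ((D.comap f).dual) s' LinearMap.id LinearMap.id fun _ => rfl).symm v

/-- The same the other way. [cite: Schmid1973, §2] -/
theorem homRat_comap_dual_id_apply (s' : S') (v : D.dual.V.fiber (f s')) : ((D.comap f).dual).homRat (D.dual.comap f) s' LinearMap.id v = v :=
  LinearMap.congr_fun (((D.comap f).dual).homRat_unique (D.dual.comap f) s' LinearMap.id LinearMap.id fun _ => rfl).symm v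

/-- **`f*(D^∨) ≅ (f*D)^∨`**: identity lattice maps (the fibres are literally the same), flat because `f*(V^∨)` and `(f*V)^∨` have the same transports
(`LocalSystem.dual_comap_transport`), Hodge because the Hodge structures at `s'` are both `(D.hodge (f s'))^∨`. [cite: Deligne1970, I.1] [cite: Schmid1973, §2] -/
def Iso.dualComap : Iso (D.dual.comap f) ((D.comap f).dual) where
  hom := Hom.ofFlat (fun _ => LinearMap.id) (fun γ u => LinearMap.congr_fun (D.VZ.dual_comap_transport f γ) u) fun s' p =>
    map_baseChange_le_of_forall_eq (V := D.dual.V.fiber (f s')) _ (homRat_dual_comap_id_apply f D s') ((D.dual.hodge (f s')).F p)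
  inv := Hom.ofFlat (fun _ => LinearMap.id) (fun γ u => LinearMap.congr_fun (D.VZ.dual_comap_transport f γ).symm u) fun s' p =>
    map_baseChange_le_of_forall_eq (V := D.dual.V.fiber (f s')) _ (homRat_comap_dual_id_apply f D s') ((D.dual.hodge (f s')).F p)
  inv_comp_hom := Hom.ext_of_app _ _ fun _ => rfl
  hom_comp_inv := Hom.ext_of_app _ _ fun _ => rfl

/-- On lattices `Iso.dualComap` is the identity. [cite: Schmid1973, §2] -/
@[simp] theorem Iso.dualComap_hom_app (s' : S') : (Iso.dualComap f D).hom.app s' = LinearMap.id := rfl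

/-- On lattices its inverse is the identity. [cite: Schmid1973, §2] -/
@[simp] theorem Iso.dualComap_inv_app (s' : S') : (Iso.dualComap f D).inv.app s' = LinearMap.id := rfl

/-- **`f*(D^∨) ≅ (f*D)^∨` is an isometry** (same forms, identity maps). [cite: Schmid1973, §2] -/
theorem Iso.isIsometry_dualComap_hom : (Iso.dualComap f D).hom.IsIsometry := fun s' x y =>
  congrArg₂ (fun a b => (D.dual.form (f s')).form a b) (homRat_dual_comap_id_apply f D s' x) (homRat_dual_comap_id_apply f D s' y)

/-- **The CDK loci of `(f*D)^∨` are the preimages of those of `D^∨`.** [cite: CattaniDeligneKaplan1995, «Proof of 1.5 ⟹ 1.1» (p. 485)] -/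
theorem hodgeLocusOfNormLe_comap_dual (p K : ℤ) : ((D.comap f).dual).hodgeLocusOfNormLe p K = f ⁻¹' D.dual.hodgeLocusOfNormLe p K := by
  rw [← (Iso.dualComap f D).hodgeLocusOfNormLe_eq (Iso.isIsometry_dualComap_hom f D), hodgeLocusOfNormLe_comap]

end Dual

section Hom

variable (D₁ D₂ : VHSData S k)

/-- **`f*Hom(D₁, D₂) ≅ Hom(f*D₁, f*D₂)`** (`Hom = D₁^∨ ⊗ D₂` cast: `Iso.dualComap ⊗ refl`, cast). [cite: Deligne1970, I.1] [cite: Schmid1973, §2] -/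
def Iso.homComap : Iso ((D₁.hom D₂).comap f) ((D₁.comap f).hom (D₂.comap f)) :=
  ((Iso.dualComap f D₁).tensor (Iso.refl (D₂.comap f))).castMap (neg_add_eq_sub k k)

/-- `f*Hom(D₁, D₂) ≅ Hom(f*D₁, f*D₂)` is an isometry. [cite: Schmid1973, §2] -/
theorem Iso.isIsometry_homComap_hom : (Iso.homComap f D₁ D₂).hom.IsIsometry :=
  ((Iso.dualComap f D₁).tensor (Iso.refl (D₂.comap f))).isIsometry_castMap_hom_iff (neg_add_eq_sub k k) |>.2
    ((Iso.isIsometry_dualComap_hom f D₁).tensor (Hom.isIsometry_id _))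

/-- **The CDK loci of `Hom(f*D₁, f*D₂)` are the preimages of those of `Hom(D₁, D₂)`.** [cite: CattaniDeligneKaplan1995, «Proof of 1.5 ⟹ 1.1» (p. 485)] -/
theorem hodgeLocusOfNormLe_comap_hom (p K : ℤ) :
    ((D₁.comap f).hom (D₂.comap f)).hodgeLocusOfNormLe p K = f ⁻¹' (D₁.hom D₂).hodgeLocusOfNormLe p K := by
  rw [← (Iso.homComap f D₁ D₂).hodgeLocusOfNormLe_eq (Iso.isIsometry_homComap_hom f D₁ D₂), hodgeLocusOfNormLe_comap]

end Hom

section TensorSpace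

variable (D : VHSData S k)

/-- **`f*(T^{a,b} D) ≅ T^{a,b}(f*D)`** (`f*(D^{⊗a}) = (f*D)^{⊗a}` on the nose, `f*((D^∨)^{⊗b}) = (f*D^∨)^{⊗b} ≅ ((f*D)^∨)^{⊗b}`).
[cite: Deligne1970, I.1] [cite: Schmid1973, §2] -/
def Iso.tensorSpaceComap (a b : ℕ) : Iso ((D.tensorSpace a b).comap f) ((D.comap f).tensorSpace a b) :=
  (Iso.ofEq (comap_tensorPow f D a)).tensor ((Iso.ofEq (comap_tensorPow f D.dual b)).trans ((Iso.dualComap f D).tensorPow b))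

/-- `f*(T^{a,b} D) ≅ T^{a,b}(f*D)` is an isometry. [cite: Schmid1973, §2] -/
theorem Iso.isIsometry_tensorSpaceComap_hom (a b : ℕ) : (Iso.tensorSpaceComap f D a b).hom.IsIsometry :=
  (Iso.isIsometry_ofEq_hom _).tensor (Iso.isIsometry_trans_hom (Iso.isIsometry_ofEq_hom _) ((Iso.isIsometry_dualComap_hom f D).tensorPow b))

/-- **The CDK loci of `T^{a,b}(f*D)` are the preimages of those of `T^{a,b} D`.** [cite: CattaniDeligneKaplan1995, «Proof of 1.5 ⟹ 1.1» (p. 485)] -/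
theorem hodgeLocusOfNormLe_comap_tensorSpace (a b : ℕ) (p K : ℤ) :
    ((D.comap f).tensorSpace a b).hodgeLocusOfNormLe p K = f ⁻¹' (D.tensorSpace a b).hodgeLocusOfNormLe p K := by
  rw [← (Iso.tensorSpaceComap f D a b).hodgeLocusOfNormLe_eq (Iso.isIsometry_tensorSpaceComap_hom f D a b), hodgeLocusOfNormLe_comap]

end TensorSpace

/-! ## §3 The CDK loci of the on-the-nose constructions of `f*D` -/

/-- **`hodgeLocusOfNormLe ((f*D)^{⊗m}) = f⁻¹' hodgeLocusOfNormLe (D^{⊗m})`.** [cite: CattaniDeligneKaplan1995, «Proof of 1.5 ⟹ 1.1» (p. 485)] -/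
theorem hodgeLocusOfNormLe_comap_tensorPow (D : VHSData S k) (m : ℕ) (p K : ℤ) :
    ((D.comap f).tensorPow m).hodgeLocusOfNormLe p K = f ⁻¹' (D.tensorPow m).hodgeLocusOfNormLe p K := by
  rw [← comap_tensorPow, hodgeLocusOfNormLe_comap]

/-- **`hodgeLocusOfNormLe (f*D₁ ⊗ f*D₂) = f⁻¹' hodgeLocusOfNormLe (D₁ ⊗ D₂)`.** [cite: CattaniDeligneKaplan1995, «Proof of 1.5 ⟹ 1.1» (p. 485)] -/
theorem hodgeLocusOfNormLe_comap_tensor (D₁ : VHSData S k₁) (D₂ : VHSData S k₂) (p K : ℤ) :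
    ((D₁.comap f).tensor (D₂.comap f)).hodgeLocusOfNormLe p K = f ⁻¹' (D₁.tensor D₂).hodgeLocusOfNormLe p K :=
  hodgeLocusOfNormLe_comap (D₁.tensor D₂) f p K

/-- `hodgeLocusOfNormLe (f*D₁ ⊕ f*D₂) = f⁻¹' hodgeLocusOfNormLe (D₁ ⊕ D₂)`. [cite: CattaniDeligneKaplan1995, «Proof of 1.5 ⟹ 1.1» (p. 485)] -/
theorem hodgeLocusOfNormLe_comap_prod (D₁ D₂ : VHSData S k) (p K : ℤ) :
    ((D₁.comap f).prod (D₂.comap f)).hodgeLocusOfNormLe p K = f ⁻¹' (D₁.prod D₂).hodgeLocusOfNormLe p K :=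
  hodgeLocusOfNormLe_comap (D₁.prod D₂) f p K

end VHSData

end Literature.AlgebraicGeometry.Motives

end
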